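import Summits.HubbardSuperconductivity.HubbardSuperconductivity.Theorems.ThermalWedgeTwTipContinuationCrossRoute
import Summits.HubbardSuperconductivity.HubbardSuperconductivity.Theorems.ChiralWindowCwThesisBlockGroundEnergy
import Summits.HubbardSuperconductivity.HubbardSuperconductivity.Theorems.NoGoNogoThesis
import Literature.MathematicalPhysics.QuantumLattice.LiebFluxPhaseProofs
import Literature.MathematicalPhysics.QuantumLattice.HubbardWave0LiebProofs

/-!
# `TwTipContinuation` (stmt-HubbardSuperconductivity-1700) — line `SketchK5`
# (idea `sharp-sandwich-thermal-tip`): the lead's SKELETON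

Crux (route `ThermalWedge`, rank 6): `TwTipContinuation`. By the landed normal forms
(`Negative/TipNormalForm`, `AnchorDischarge` p85630, `CrossRoute` p92871) the crux is the `U`-uniform
every-ground-state d-wave order window of the PURE torus, and it follows from the canonical
pair-penalty response `c·κ ≤ E_L(U;κ) − E_L(U;0)` eventually along even `L`, for all small `U` at one
doping `δ ∈ [1/10,2/5]` (`CrossRoute.twTipContinuation_of_penaltyResponseWindow`).

The line (card `Ideas/sharp-sandwich-thermal-tip.md`) reaches that response THERMALLY, at the
polynomial schedule `β_L = C·L`, in the `(N_L, S^z = 0)` sector block `A_L := H_L|_p`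
(`p s :≡ #↑s = #↓s = n_L`, `n_L = ⌊(1−δ)L²/2⌋`) with the compressed penalty
`B_L := (H_L + (κ/L⁴) Δ_dᴴΔ_d)|_p`:

  `E₀(B_L) − E₀(A_L) ≥ F_β(B_L) − E₀(A_L) = [F_β(B_L) − F_β(A_L)] − [E₀(A_L) − F_β(A_L)]`

(`F_β(K) = −β⁻¹ log Z_β(K) ≤ E₀(K)`: keep the ground term of `Z`). So two research stubs suffice:

* `stub_thermalPenalty` (A): thermal q = 0 pair-penalty RESPONSE `a·κ ≤ F_{CL}(B_L) − F_{CL}(A_L)`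
  at one `δ` of the window, for all `U ∈ (0,U₁]`, some `κ, a > 0`, all `C ≥ C₀`, eventually in even `L`;
* `stub_depletion` (B): order-blind DEPLETION bound `E₀(A_L) − F_{CL}(A_L) ≤ ε` for every `δ` of
  the window, all `U ∈ (0,U₁(δ)]`, every `ε > 0`, all `C ≥ C₁(ε)`, eventually in even `L`;

and the composition `TwTipContinuation_of` is: pick `δ, κ, a` from (A), `ε := aκ/2` in (B),
`C := max C₀ C₁`, then `(a/2)·κ ≤ E₀(B_L) − E₀(A_L) = E_L(U;κ) − E_L(U;0)` (block ground energy =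
sector energy, `CwThesis.stub_blockGroundEnergy`) eventually along `L = 2(k+1)`, and the landed door
`twTipContinuation_of_penaltyResponseWindow` concludes the crux BY NAME.

Typing discipline (Disproof §10, card §Transfer): `δ` is chosen BEFORE `U` in (A); (B) is asked at
every `δ` of the window (it is order-blind), so the two stubs are independent work units.
No definition is introduced (free energies are written `-(1/β) * Real.log (partitionFn β K).re`).
-/

noncomputable section

-- `dupNamespace`: the summit and the problem are both named `HubbardSuperconductivity` (layout D-0022)
set_option linter.dupNamespace false
-- the `(n,n)`-sector index type `{s : Finset (Orb Λ) // …}` needs a larger instance budget for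
-- `DecidableEq` (structural instance through `Lex (Fin 2 → Fin L)`; tree precedent: CwThesisBlockGroundEnergy)
set_option synthInstance.maxSize 512

namespace Summit.HubbardSuperconductivity.TwTipContinuation.SharpSandwich

open Matrix Filter Literature.MathematicalPhysics.QuantumLattice Literature.Probability.LatticeModels
open Summit.HubbardSuperconductivity.HubbardSuperconductivity.Theses.ThermalWedge
open scoped ComplexOrder

/-! ### The one-sided sandwich on a finite Hermitian matrix -/

section Generic

variable {m : Type*} [Fintype m] [DecidableEq m]

/-- **`F_β(K) ≤ E₀(K)`**: the free energy `−β⁻¹ log Z_β(K)` of a Hermitian matrix on a nonempty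
index type never exceeds its ground energy (`e^{−βE₀} ≤ Z_β`, keep the ground-state term).
Ruelle, *Statistical Mechanics* (1969) §2.5. [folklore] -/
theorem freeEnergy_le_groundEnergy [Nonempty m] {K : Matrix m m ℂ} (hK : K.IsHermitian) {β : ℝ}
    (hβ : 0 < β) : -(1 / β) * Real.log (partitionFn β K).re ≤ K.groundEnergy := by
  have h2 := Real.log_le_log (Real.exp_pos _) (exp_neg_mul_groundEnergy_le_partitionFn hK β)
  rw [Real.log_exp] at h2
  have hβ' : 0 < 1 / β := by positivity
  have h3 : -(β * K.groundEnergy) * (1 / β) ≤ Real.log (partitionFn β K).re * (1 / β) :=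
    mul_le_mul_of_nonneg_right h2 hβ'.le
  have hs : -(β * K.groundEnergy) * (1 / β) = -K.groundEnergy := by field_simp
  rw [hs] at h3
  nlinarith

/-- **The sharp sandwich, spectral form.** For Hermitian `B` (nonempty index type), `β > 0` and any
matrix `A`: a thermal penalty response `x ≤ F_β(B) − F_β(A)` and a depletion bound
`E₀(A) − F_β(A) ≤ y` give the ZERO-temperature response `x − y ≤ E₀(B) − E₀(A)`
(since `F_β(B) ≤ E₀(B)`). Ruelle (1969) §2.5. [folklore] -/
theorem groundEnergy_sub_ge_of_sandwich [Nonempty m] {A B : Matrix m m ℂ} (hB : B.IsHermitian)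
    {β x y : ℝ} (hβ : 0 < β)
    (hpen : x ≤ -(1 / β) * Real.log (partitionFn β B).re - -(1 / β) * Real.log (partitionFn β A).re)
    (hdep : A.groundEnergy - -(1 / β) * Real.log (partitionFn β A).re ≤ y) :
    x - y ≤ B.groundEnergy - A.groundEnergy := by
  have := freeEnergy_le_groundEnergy hB hβ
  linarith

end Generic

/-! ### Torus bookkeeping -/

/-- Lieb's `(n,n)` occupation sector of the torus of side `L` is nonempty for `n ≤ L²`
(`pairSet α α` for an `n`-subset `α` of the `L²` sites). Lieb, PRL 62 (1989) 1201. [folklore] -/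
theorem nonempty_sector (L : ℕ) {n : ℕ} (hn : n ≤ L ^ 2) :
    Nonempty {s : Finset (Orb (FermionTorus 2 L)) // (upPart s).card = n ∧ (downPart s).card = n} := by
  have hcard : Fintype.card (FermionTorus 2 L) = L ^ 2 :=
    Summit.HubbardSuperconductivity.NoGo.card_fermionTorus_two L
  obtain ⟨α, -, hα⟩ := Finset.exists_subset_card_eq (s := (Finset.univ : Finset (FermionTorus 2 L)))
    (n := n) (by rw [Finset.card_univ, hcard]; exact hn)
  exact ⟨⟨pairSet α α, by rw [upPart_pairSet, hα], by rw [downPart_pairSet, hα]⟩⟩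

/-- The penalised torus Hamiltonian `H_L(U) + (κ/L⁴) Δ_dᴴ Δ_d` is Hermitian. [folklore] -/
theorem isHermitian_penalised (L : ℕ) [NeZero L] (U κ : ℝ) :
    (hubbardTorus 2 L 1 U + ((κ / (L : ℝ) ^ 4 : ℝ) : ℂ) •
        ((pairField dWaveFormFactor L)ᴴ * pairField dWaveFormFactor L)).IsHermitian := by
  have h1 : (hubbardTorus 2 L 1 U).IsHermitian := LiebThm1.hamiltonian_isHermitian _ 1 U
  have h2 : ((pairField dWaveFormFactor L)ᴴ * pairField dWaveFormFactor L).IsHermitian :=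
    (pairField_conjTranspose_mul_self_posSemidef dWaveFormFactor L).isHermitian
  refine h1.add ?_
  unfold Matrix.IsHermitian
  rw [conjTranspose_smul, h2.eq, Complex.star_def, Complex.conj_ofReal]

/-! ### Research stubs (registered; sorries live ONLY here) -/

/-- **Stub (A) — thermal q = 0 pair-penalty response at the polynomial schedule `β_L = C·L`.**
At ONE doping `δ ∈ [1/10,2/5]` (chosen before `U`), for every `U ∈ (0,U₁]` there are a penalty
strength `κ > 0`, a response `a > 0` and an aspect ratio `C₀` such that for every `C ≥ C₀`,
eventually in even `L`, the `(N_L,S^z=0)`-sector free energies of the pure torus respond to the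
compressed d-wave pair penalty `(κ/L⁴) Δ_dᴴΔ_d` by at least `a·κ`:
`a κ ≤ F_{CL}(B_L) − F_{CL}(A_L)`. The bet of the line (card §Barriers: `WeakCouplingCeiling`
bites; size set by the stiffness `ρ_s`, `a ≍ min(m(U)², ρ_s/κ)`). [folklore] -/
theorem stub_thermalPenalty :
    ∃ U₁ : ℝ, 0 < U₁ ∧ ∃ δ ∈ Set.Icc (1 / 10 : ℝ) (2 / 5), ∀ U ∈ Set.Ioc (0 : ℝ) U₁,
      ∃ κ : ℝ, 0 < κ ∧ ∃ a : ℝ, 0 < a ∧ ∃ C₀ : ℝ, ∀ C : ℝ, C₀ ≤ C →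
        ∃ L₀ : ℕ, ∀ (L : ℕ) [NeZero L], L₀ ≤ L → Even L →
          a * κ ≤
            -(1 / (C * L)) * Real.log (partitionFn (C * L)
                ((hubbardTorus 2 L 1 U + ((κ / (L : ℝ) ^ 4 : ℝ) : ℂ) •
                    ((pairField dWaveFormFactor L)ᴴ * pairField dWaveFormFactor L)).toBlock
                  (fun s => (upPart s).card = ⌊(1 - δ) * (L : ℝ) ^ 2 / 2⌋₊ ∧
                    (downPart s).card = ⌊(1 - δ) * (L : ℝ) ^ 2 / 2⌋₊)
                  (fun s => (upPart s).card = ⌊(1 - δ) * (L : ℝ) ^ 2 / 2⌋₊ ∧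
                    (downPart s).card = ⌊(1 - δ) * (L : ℝ) ^ 2 / 2⌋₊))).re -
            -(1 / (C * L)) * Real.log (partitionFn (C * L)
                ((hubbardTorus 2 L 1 U).toBlock
                  (fun s => (upPart s).card = ⌊(1 - δ) * (L : ℝ) ^ 2 / 2⌋₊ ∧
                    (downPart s).card = ⌊(1 - δ) * (L : ℝ) ^ 2 / 2⌋₊)
                  (fun s => (upPart s).card = ⌊(1 - δ) * (L : ℝ) ^ 2 / 2⌋₊ ∧
                    (downPart s).card = ⌊(1 - δ) * (L : ℝ) ^ 2 / 2⌋₊))).re := by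
  sorry

/-- **Stub (B) — order-blind depletion bound for the PURE torus at `β_L = C·L`.** At every doping
`δ ∈ [1/10,2/5]`, for every `U ∈ (0,U₁(δ)]` and every `ε > 0` there is an aspect ratio `C₁ > 0` such
that for every `C ≥ C₁`, eventually in even `L`, the `(N_L,S^z=0)`-sector block `A_L = H_L|_p` of
the pure torus satisfies `D_{CL}(A_L) := E₀(A_L) − F_{CL}(A_L) ≤ ε`, i.e.
`Σₙ e^{−CL(Eₙ−E₀)} ≤ e^{εCL}` (entropy tail; tolerates `e^{O(L)}` near-degeneracy; Fermi-liquid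
heuristic `D ≈ γ/(2C²)`). [folklore] -/
theorem stub_depletion :
    ∀ δ ∈ Set.Icc (1 / 10 : ℝ) (2 / 5), ∃ U₁ : ℝ, 0 < U₁ ∧ ∀ U ∈ Set.Ioc (0 : ℝ) U₁,
      ∀ ε : ℝ, 0 < ε → ∃ C₁ : ℝ, 0 < C₁ ∧ ∀ C : ℝ, C₁ ≤ C →
        ∃ L₀ : ℕ, ∀ (L : ℕ) [NeZero L], L₀ ≤ L → Even L →
          ((hubbardTorus 2 L 1 U).toBlock
              (fun s => (upPart s).card = ⌊(1 - δ) * (L : ℝ) ^ 2 / 2⌋₊ ∧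
                (downPart s).card = ⌊(1 - δ) * (L : ℝ) ^ 2 / 2⌋₊)
              (fun s => (upPart s).card = ⌊(1 - δ) * (L : ℝ) ^ 2 / 2⌋₊ ∧
                (downPart s).card = ⌊(1 - δ) * (L : ℝ) ^ 2 / 2⌋₊)).groundEnergy -
            -(1 / (C * L)) * Real.log (partitionFn (C * L)
                ((hubbardTorus 2 L 1 U).toBlock
                  (fun s => (upPart s).card = ⌊(1 - δ) * (L : ℝ) ^ 2 / 2⌋₊ ∧
                    (downPart s).card = ⌊(1 - δ) * (L : ℝ) ^ 2 / 2⌋₊)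
                  (fun s => (upPart s).card = ⌊(1 - δ) * (L : ℝ) ^ 2 / 2⌋₊ ∧
                    (downPart s).card = ⌊(1 - δ) * (L : ℝ) ^ 2 / 2⌋₊))).re ≤ ε := by
  sorry

/-! ### Composition: (A) ∧ (B) ⇒ canonical penalty response ⇒ the crux by name -/

/-- **(A) ∧ (B) ⇒ the canonical pair-penalty response window** (the hypothesis of the landed door
`CrossRoute.twTipContinuation_of_penaltyResponseWindow`): at the doping of (A), for all
`U < min U₁ U₂`, with `ε := aκ/2` and `C := max C₀ C₁`, the sandwich gives
`(a/2) κ ≤ E₀(B_L) − E₀(A_L)`, and block ground energies are the sector energies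
(`CwThesis.stub_blockGroundEnergy`). [folklore] -/
theorem penaltyResponseWindow_of_stubs
    (hA : ∃ U₁ : ℝ, 0 < U₁ ∧ ∃ δ ∈ Set.Icc (1 / 10 : ℝ) (2 / 5), ∀ U ∈ Set.Ioc (0 : ℝ) U₁,
      ∃ κ : ℝ, 0 < κ ∧ ∃ a : ℝ, 0 < a ∧ ∃ C₀ : ℝ, ∀ C : ℝ, C₀ ≤ C →
        ∃ L₀ : ℕ, ∀ (L : ℕ) [NeZero L], L₀ ≤ L → Even L →
          a * κ ≤
            -(1 / (C * L)) * Real.log (partitionFn (C * L)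
                ((hubbardTorus 2 L 1 U + ((κ / (L : ℝ) ^ 4 : ℝ) : ℂ) •
                    ((pairField dWaveFormFactor L)ᴴ * pairField dWaveFormFactor L)).toBlock
                  (fun s => (upPart s).card = ⌊(1 - δ) * (L : ℝ) ^ 2 / 2⌋₊ ∧
                    (downPart s).card = ⌊(1 - δ) * (L : ℝ) ^ 2 / 2⌋₊)
                  (fun s => (upPart s).card = ⌊(1 - δ) * (L : ℝ) ^ 2 / 2⌋₊ ∧
                    (downPart s).card = ⌊(1 - δ) * (L : ℝ) ^ 2 / 2⌋₊))).re -
            -(1 / (C * L)) * Real.log (partitionFn (C * L)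
                ((hubbardTorus 2 L 1 U).toBlock
                  (fun s => (upPart s).card = ⌊(1 - δ) * (L : ℝ) ^ 2 / 2⌋₊ ∧
                    (downPart s).card = ⌊(1 - δ) * (L : ℝ) ^ 2 / 2⌋₊)
                  (fun s => (upPart s).card = ⌊(1 - δ) * (L : ℝ) ^ 2 / 2⌋₊ ∧
                    (downPart s).card = ⌊(1 - δ) * (L : ℝ) ^ 2 / 2⌋₊))).re)
    (hB : ∀ δ ∈ Set.Icc (1 / 10 : ℝ) (2 / 5), ∃ U₁ : ℝ, 0 < U₁ ∧ ∀ U ∈ Set.Ioc (0 : ℝ) U₁,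
      ∀ ε : ℝ, 0 < ε → ∃ C₁ : ℝ, 0 < C₁ ∧ ∀ C : ℝ, C₁ ≤ C →
        ∃ L₀ : ℕ, ∀ (L : ℕ) [NeZero L], L₀ ≤ L → Even L →
          ((hubbardTorus 2 L 1 U).toBlock
              (fun s => (upPart s).card = ⌊(1 - δ) * (L : ℝ) ^ 2 / 2⌋₊ ∧
                (downPart s).card = ⌊(1 - δ) * (L : ℝ) ^ 2 / 2⌋₊)
              (fun s => (upPart s).card = ⌊(1 - δ) * (L : ℝ) ^ 2 / 2⌋₊ ∧
                (downPart s).card = ⌊(1 - δ) * (L : ℝ) ^ 2 / 2⌋₊)).groundEnergy -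
            -(1 / (C * L)) * Real.log (partitionFn (C * L)
                ((hubbardTorus 2 L 1 U).toBlock
                  (fun s => (upPart s).card = ⌊(1 - δ) * (L : ℝ) ^ 2 / 2⌋₊ ∧
                    (downPart s).card = ⌊(1 - δ) * (L : ℝ) ^ 2 / 2⌋₊)
                  (fun s => (upPart s).card = ⌊(1 - δ) * (L : ℝ) ^ 2 / 2⌋₊ ∧
                    (downPart s).card = ⌊(1 - δ) * (L : ℝ) ^ 2 / 2⌋₊))).re ≤ ε) :
    ∃ δ ∈ Set.Icc (1 / 10 : ℝ) (2 / 5), ∃ U₀ : ℝ, 0 < U₀ ∧ ∀ U ∈ Set.Ioo (0 : ℝ) U₀,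
      ∃ κ : ℝ, 0 < κ ∧ ∃ c : ℝ, 0 < c ∧ ∀ᶠ k : ℕ in Filter.atTop,
        c * κ ≤
          Matrix.minEnergyOn (hubbardTorus 2 (2 * (k + 1)) 1 U +
              ((κ / ((2 * (k + 1) : ℕ) : ℝ) ^ 4 : ℝ) : ℂ) •
                ((pairField dWaveFormFactor (2 * (k + 1)))ᴴ * pairField dWaveFormFactor (2 * (k + 1))))
            (szSector (2 * ⌊(1 - δ) * ((2 * (k + 1) : ℕ) : ℝ) ^ 2 / 2⌋₊) 0) -
          Matrix.minEnergyOn (hubbardTorus 2 (2 * (k + 1)) 1 U)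
            (szSector (2 * ⌊(1 - δ) * ((2 * (k + 1) : ℕ) : ℝ) ^ 2 / 2⌋₊) 0) := by
  obtain ⟨U₁, hU₁, δ, hδ, hAU⟩ := hA
  obtain ⟨U₂, hU₂, hBU⟩ := hB δ hδ
  refine ⟨δ, hδ, min U₁ U₂, lt_min hU₁ hU₂, fun U hU => ?_⟩
  obtain ⟨κ, hκ, a, ha, C₀, hAC⟩ := hAU U ⟨hU.1, hU.2.le.trans (min_le_left _ _)⟩
  obtain ⟨C₁, hC₁, hBC⟩ :=
    hBU U ⟨hU.1, hU.2.le.trans (min_le_right _ _)⟩ (a * κ / 2) (by positivity)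
  obtain ⟨L₀, hL₀⟩ := hAC (max C₀ C₁) (le_max_left _ _)
  obtain ⟨L₁, hL₁⟩ := hBC (max C₀ C₁) (le_max_right _ _)
  refine ⟨κ, hκ, a / 2, by positivity, Filter.eventually_atTop.2 ⟨L₀ + L₁, fun k hk => ?_⟩⟩
  have hδ' : (-1 : ℝ) ≤ δ := by linarith [hδ.1]
  -- the side `L = 2(k+1)` and the half particle number `n = ⌊(1-δ)L²/2⌋ ≤ L²`
  set L : ℕ := 2 * (k + 1) with hLdef
  have hLeven : Even L := ⟨k + 1, by omega⟩
  have hn : ⌊(1 - δ) * (L : ℝ) ^ 2 / 2⌋₊ ≤ L ^ 2 :=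
    Summit.HubbardSuperconductivity.NoGo.floor_pairNumber_le δ hδ' L
  haveI := nonempty_sector L hn
  have hCpos : 0 < max C₀ C₁ := lt_of_lt_of_le hC₁ (le_max_right _ _)
  have hβ : 0 < max C₀ C₁ * (L : ℝ) := by
    have : (0 : ℝ) < (L : ℝ) := by positivity
    positivity
  have hApt := hL₀ L (by omega) hLeven
  have hBpt := hL₁ L (by omega) hLeven
  -- the sandwich on the block
  have hBh := isHermitian_penalised L U κ
  have hHh : (hubbardTorus 2 L 1 U).IsHermitian := LiebThm1.hamiltonian_isHermitian _ 1 U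
  have hsand := groundEnergy_sub_ge_of_sandwich (by exact hBh.submatrix _) hβ hApt hBpt
  -- block ground energies are the sector energies
  rw [Summit.HubbardSuperconductivity.HubbardSuperconductivity.Theorems.CwThesis.stub_blockGroundEnergy
      L _ hBh hn,
    Summit.HubbardSuperconductivity.HubbardSuperconductivity.Theorems.CwThesis.stub_blockGroundEnergy
      L _ hHh hn] at hsand
  have e : a * κ - a * κ / 2 = a / 2 * κ := by ring
  rw [e] at hsand
  exact hsand

/-- **The line closes the crux modulo its stubs**: `TwTipContinuation` from `stub_thermalPenalty` (A)
and `stub_depletion` (B) through `penaltyResponseWindow_of_stubs` and the landed door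
`CrossRoute.twTipContinuation_of_penaltyResponseWindow` (p92871). [folklore] -/
theorem TwTipContinuation_of : TwTipContinuation :=
  Summit.HubbardSuperconductivity.TwTipContinuation.CrossRoute.twTipContinuation_of_penaltyResponseWindow
    (penaltyResponseWindow_of_stubs stub_thermalPenalty stub_depletion)

end Summit.HubbardSuperconductivity.TwTipContinuation.SharpSandwich

end
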